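import Mathlib
import HarnessLib

/-!
# Symmetric spectral representations over `ℝ[x]`: reduction to irreducible polynomials

Topic `Literature/AlgebraicGeometry/DeterminantalHypersurfaces`. C. Hanselka, *Characteristic
polynomials of symmetric matrices over the univariate polynomial ring*, J. Algebra 487 (2017)
340–356 (arXiv:1610.06634), **§5, first paragraph of the proof of Theorem 1**: "To prove that
`f` is the characteristic polynomial of a symmetric matrix over `ℝ[x]` we may assume that `f`
is irreducible. Otherwise we find a symmetric spectral representation of each of its irreducible
factors and compose them to a block diagonal matrix which then gives a symmetric spectral
representation of `f`."

Hanselka's Theorem 1 (a monic `f ∈ ℝ[x][t]` all of whose fibres `f(a,·)`, `a ∈ ℝ`, are real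
rooted is `det(tI − M)` for a symmetric `M ∈ Mₙ(ℝ[x])`) is the explicit hypothesis `H` of
`laxConjecture_of_symmSpectralRepresentation` (`HeltonVinnikovProofs.lean`), through which it
implies the Lax conjecture / Helton–Vinnikov theorem (`LewisParriloRamana2005_laxConjecture`).
This file proves, sorry-free, the reduction of that hypothesis `H` (verbatim) to the case of
IRREDUCIBLE `f`:

* `card_roots_map_of_mul` — a factorisation `f = g h` into monic factors of a polynomial with
  real-rooted fibres has factors with real-rooted fibres [folklore];
* `exists_monic_irreducible_mul_eq` — a monic non-constant `f ∈ ℝ[x][t]` factors as `g h` with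
  `g` monic irreducible and `h` monic (`ℝ[x][t]` is a UFD and the leading coefficient of a
  factor of a monic polynomial is a unit) [folklore];
* `symmSpectralRepresentation_of_irreducible` — **the reduction** [cite: Hanselka2017, §5]:
  if every monic irreducible `f ∈ ℝ[x][t]` with real-rooted fibres has a symmetric spectral
  representation, then so does every monic `f` with real-rooted fibres (block-diagonal
  composition `fromBlocks M_g 0 0 M_h`, `charpoly_fromBlocks_zero₁₂`), in exactly the form `H`.

What remains for `H` is therefore Hanselka's Theorem 1 for irreducible `f` (ibid. §§2–5: the
codifferent of the normalisation, absence of real ramification, 2-divisibility of the class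
group of the complex curve, and the Harder–Djoković theorem — the last is
`Literature.LinearAlgebra.QuadraticForm.exists_isUnit_transpose_mul_mul_eq_one`).

## References

* [Hanselka2017] C. Hanselka, J. Algebra 487 (2017) 340–356: Thm. 1 and §5 (proof, first
  paragraph).
-/

noncomputable section

open Polynomial Matrix

namespace Literature.AlgebraicGeometry.DeterminantalHypersurfaces

/-- **Factors of real-rooted families are real rooted.** If `g, h ∈ ℝ[x][t]` are monic and the
fibre of `g h` over `a ∈ ℝ` has `deg (g h)` real roots, then the fibres of `g` and `h` over `a`
have `deg g` resp. `deg h` real roots. [folklore] -/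
theorem card_roots_map_of_mul {g h : ℝ[X][X]} (hg : g.Monic) (hh : h.Monic) (a : ℝ)
    (hgh : Multiset.card ((g * h).map (evalRingHom a)).roots = (g * h).natDegree) :
    Multiset.card (g.map (evalRingHom a)).roots = g.natDegree ∧
      Multiset.card (h.map (evalRingHom a)).roots = h.natDegree := by
  have hg' := hg.map (evalRingHom a)
  have hh' := hh.map (evalRingHom a)
  rw [Polynomial.map_mul, roots_mul (mul_ne_zero hg'.ne_zero hh'.ne_zero), Multiset.card_add,
    hg.natDegree_mul hh] at hgh
  have h1 := card_roots' (g.map (evalRingHom a))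
  have h2 := card_roots' (h.map (evalRingHom a))
  rw [hg.natDegree_map] at h1
  rw [hh.natDegree_map] at h2
  omega

/-- **A monic irreducible factor.** A monic `f ≠ 1` in `ℝ[x][t]` is `g h` with `g` monic
irreducible and `h` monic. [folklore] -/
theorem exists_monic_irreducible_mul_eq {f : ℝ[X][X]} (hf : f.Monic) (hf1 : f ≠ 1) :
    ∃ g h : ℝ[X][X], Irreducible g ∧ g.Monic ∧ h.Monic ∧ f = g * h := by
  have hnu : ¬ IsUnit f := fun hu => hf1 (hf.isUnit_iff.mp hu)
  obtain ⟨g, hgirr, h, hfgh⟩ := WfDvdMonoid.exists_irreducible_factor hnu hf.ne_zero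
  obtain ⟨u, hu⟩ := hf.isUnit_leadingCoeff_of_dvd (Dvd.intro h hfgh.symm)
  have hCu : IsUnit (C (↑u⁻¹ : ℝ[X]) : ℝ[X][X]) := isUnit_C.mpr (Units.isUnit u⁻¹)
  have hg0 : g ≠ 0 := hgirr.ne_zero
  have hh0 : h ≠ 0 := by
    rintro rfl
    rw [mul_zero] at hfgh
    exact hf.ne_zero hfgh
  have hgm : (C (↑u⁻¹ : ℝ[X]) * g).Monic := by
    rw [Monic, leadingCoeff_mul, leadingCoeff_C, ← hu, Units.inv_mul]
  have hfac : f = (C (↑u⁻¹ : ℝ[X]) * g) * (C (↑u : ℝ[X]) * h) := by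
    rw [hfgh]
    calc g * h = (C (↑u⁻¹ : ℝ[X]) * C (↑u : ℝ[X])) * (g * h) := by
          rw [← C_mul, Units.inv_mul, C_1, one_mul]
      _ = C (↑u⁻¹ : ℝ[X]) * g * (C (↑u : ℝ[X]) * h) := by ring
  refine ⟨C (↑u⁻¹ : ℝ[X]) * g, C (↑u : ℝ[X]) * h, (irreducible_isUnit_mul hCu).mpr hgirr, hgm,
    ?_, hfac⟩
  exact hgm.of_mul_monic_left (hfac ▸ hf)

/-- **Reduction of Hanselka's Theorem 1 to irreducible polynomials** ([Hanselka2017, §5, first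
paragraph of the proof]): if every monic IRREDUCIBLE `f ∈ ℝ[x][t]` all of whose fibres
`f(a, ·)`, `a ∈ ℝ`, have `deg f` real roots is the characteristic polynomial of a symmetric
matrix over `ℝ[x]`, then the same holds for every monic `f` with real-rooted fibres — in
exactly the form of the hypothesis `H` of `laxConjecture_of_symmSpectralRepresentation`.
Proof: factor off a monic irreducible `g`, represent `g` and (inductively) the cofactor `h`,
and take the block-diagonal matrix, `charpoly (fromBlocks M_g 0 0 M_h) = charpoly M_g ·
charpoly M_h`. [cite: Hanselka2017, §5 (proof of Theorem 1, reduction to irreducible f)] -/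
theorem symmSpectralRepresentation_of_irreducible
    (Hirr : ∀ f : ℝ[X][X], Irreducible f → f.Monic →
      (∀ a : ℝ, Multiset.card (f.map (evalRingHom a)).roots = f.natDegree) →
      ∃ M : Matrix (Fin f.natDegree) (Fin f.natDegree) ℝ[X], M.IsSymm ∧ M.charpoly = f) :
    ∀ (n : ℕ) (f : ℝ[X][X]), f.Monic → f.natDegree = n →
      (∀ a : ℝ, Multiset.card (f.map (evalRingHom a)).roots = n) →
      ∃ M : Matrix (Fin n) (Fin n) ℝ[X], M.IsSymm ∧ M.charpoly = f := by
  intro n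
  induction n using Nat.strong_induction_on with
  | _ n ih =>
  intro f hf hn hroots
  by_cases h1 : f = 1
  · subst h1
    rw [natDegree_one] at hn
    subst hn
    exact ⟨0, Matrix.isSymm_zero, by rw [charpoly_isEmpty]⟩
  obtain ⟨g, h, hgirr, hg, hh, rfl⟩ := exists_monic_irreducible_mul_eq hf h1
  have hdeg : (g * h).natDegree = g.natDegree + h.natDegree := hg.natDegree_mul hh
  have hfib : ∀ a : ℝ, Multiset.card (g.map (evalRingHom a)).roots = g.natDegree ∧
      Multiset.card (h.map (evalRingHom a)).roots = h.natDegree := fun a =>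
    card_roots_map_of_mul hg hh a (by rw [hroots a, hn])
  obtain ⟨Mg, hMg, hcg⟩ := Hirr g hgirr hg fun a => (hfib a).1
  have hgpos : 0 < g.natDegree := hg.natDegree_pos_of_not_isUnit hgirr.not_isUnit
  have hlt : h.natDegree < n := by omega
  obtain ⟨Mh, hMh, hch⟩ := ih _ hlt h hh rfl fun a => (hfib a).2
  -- block-diagonal composition
  have hsize : g.natDegree + h.natDegree = n := by omega
  let e : Fin g.natDegree ⊕ Fin h.natDegree ≃ Fin n := finSumFinEquiv.trans (finCongr hsize)
  refine ⟨Matrix.reindex e e (Matrix.fromBlocks Mg 0 0 Mh), ?_, ?_⟩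
  · exact (hMg.fromBlocks (by rw [transpose_zero]) hMh).submatrix _
  · rw [charpoly_reindex, charpoly_fromBlocks_zero₁₂, hcg, hch]

end Literature.AlgebraicGeometry.DeterminantalHypersurfaces
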